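import Summits.ABC.IUTFork.Repair.CandJoshi1
import Summits.ABC.IUTFork.Cor312PinnedIdentified
import HarnessLib

/-!
# IUT REPAIR branch (rung LADDER-ABC:A2.RP), class (iii) JOSHI — `CandJoshi1Tests`: (T-c) Joshi's STANDARD POINT in the naive model,
# and the separation «H_J1 is strictly weaker than the residual of record»

Companion (REPAIR-SPEC v0.2 §2: `Cand<Class><k>Tests` = the T-b/T-c part when the candidate file exceeds 400 lines; same namespace)
of `Repair/CandJoshi1.lean` (seat abc-iut-rp-j1; row RP-J01 of `HOME/plan/repair/CANDIDATES.tsv`). PROOF-ONLY apart from two toy DATA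
definitions (`stdQDatum`, `stdSetting`: a q-datum and abc-iut-w5-d247's `withQDatum` setting built from it); no `Prop` definition, no
fact, nothing asserted. TAKES NO SIDE on [IUTchIII] Cor. 3.12 and on no author; typed ≠ proved; instantiated ≠ endorsed.

WHAT IS BUILT. `stdSetting p` — JOSHI'S STANDARD POINT `z_Θ` READ IN `K_1`-UNITS (K. Joshi, arXiv:2401.13508v4 §4.5 p. 36 with
Thm. 4.2.2.1 (4) p. 33: at `z_Θ` the Θ-values have valuation vector `(j²/l⋇²)_j` against `1` for the q-value read at `y_{l⋇} = y′_0`;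
arXiv:2111.04890 §10 eq. (val-rel-main); multiplying the value group through by `l⋇²` gives `(j²)_j` against `l⋇²`): over
abc-iut-w5-d247's contentful typed-Thm-3.11 instance `naiveFull p` (Θ-pilot Kummer images `B_{j²}` at every `(n, m)`, indeterminacies
= signs) the `withQDatum` setting whose q-datum is `{(±q^{l⋇²})_j} = {(±p⁴)_j}` (`l⋇ = 2`), so that the q-pilot region is `B_4`.
[claim: Joshi2024ATSIII, status: disputed]

RESULTS (kernel, standard axioms). At `stdSetting p` with operator `ballOfMonoid p` and that datum: typed Thm. 3.11 (i)–(iii)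
(`naiveFull_statement`), every bridge hypothesis, `AbsLogQPos`, ALL THREE PINS hold; **`JoshiDominance` (H_J1) and
`JoshiVolumeDominance` (H_J2) HOLD** (identity indeterminacy, `m = 0`: `B_4 ⊆ B_{j²}`); **the residual of record `PilotKummerIndRelated`
FAILS** (`B_4 ≠ B_1` at `j = 1`), as do abc-iut-w5-d068's region- and datum-level clauses; the (xi-f) `Licence` and **the typed
Corollary 3.12 HOLD**, the Statement being derived THROUGH `statement_of_joshiDominance` (the (T-a) theorem exercised non-vacuously);
`−|log(Θ)| = −(5/2)·log p = (5/8)·(−|log(q)|)` (`5/8` = the toy value of Joshi's `(l⋇+1)(2l⋇+1)/(6 l⋇²)`, ATS II §10). Packaged: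
`joshi_standard_point_model` (the T-c witness, shape of REPAIR-SPEC §2 (4)) and `joshiDominance_strictly_weaker_than_residual`
(residual ⟹ H_J1 always; H_J1 ⇏ residual). T-c GRADE (REPAIR-SPEC §3): the q-volume is label-independent and negative, the Θ-volumes
are `j²`-scaled against `q^{1/l⋇²}`, NOT against `q` — i.e. NOT «honest» in the sense of `PinnedHonest.not_gapA''_of_scaledAt`'s
`hscaled` (there the ratio is `j²`, here `j²/l⋇²`): this is neither the degenerate SAT0 corner (the q-datum does not generate the
theta balls) nor SAT+; it is exactly the renormalisation Joshi's change of arithmetic holomorphic structure performs on the q-side, which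
the frozen pins leave free (`qK` is an uninterpreted binder) and which abc-iut-w4-d101's object-honest `qDatum = {(±q)_j}` excludes. Recorded
as «SAT (rescaled-q)» for the lead to grade. Interface/toy level; no judgement on print.
-/

noncomputable section

open Set

namespace Summit.ABC.IUTFork.Repair.CandJoshi1

open Thm311 Cor312 Cor312Vol Literature.IUT.LogThetaLattice

/-! ## 1. (T-c) Joshi's standard point in the naive model: H_J1 ∧ ¬ residual ∧ typed Thm 3.11 ∧ three pins ∧ Statement -/

section JoshiStd

open NaiveWitness Cor312.Checks Cor312.IdentifiedNonVacuity GluedMonoids.Naive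

variable (p : ℕ)

/-- **The standard-point q-datum** `{(±q^{l⋇²})_j}` (`q := p`, `l⋇ = 2`: the tuples with every component `±p⁴`): Joshi's standard
point `z_Θ` (ATS III §4.5 p. 36; Thm. 4.2.2.1 (4) p. 33) read in `K_1`-units — there the Θ-values have valuation vector
`(j²)_j·v` and the q-value, read at `y_{l⋇} = y′_0`, valuation `l⋇²·v` (ATS II §10 eq. (val-rel-main), multiplied through by `l⋇²`).
DATA of a toy; nothing asserted. [claim: Joshi2024ATSIII, status: disputed] -/
def stdQDatum (v : toyIndex.V) : Set (signShells.StarPacket v) :=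
  {f | ∀ j : toyIndex.LabelStar,
    line j.1 (toyIndex.over v) (f j) = (p : ℚ) ^ 4 ∨ line j.1 (toyIndex.over v) (f j) = -((p : ℚ) ^ 4)}

/-- The tuple `(p⁴)_j` lies in the standard-point datum. [folklore] -/
theorem stdTuple_mem_stdQDatum (v : toyIndex.V) :
    (fun j : toyIndex.LabelStar => (line j.1 (toyIndex.over v)).symm ((p : ℚ) ^ 4)) ∈ stdQDatum p v :=
  fun _ => Or.inl (LinearEquiv.apply_symm_apply _ _)

variable [hp : Fact p.Prime]

/-- Components of the standard-point datum are nonzero of valuation `4 = l⋇²`. [folklore] -/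
theorem line_stdQDatum_component {f : signShells.StarPacket ()} (hf : f ∈ stdQDatum p ()) (j : toyIndex.LabelStar) :
    line j.1 (toyIndex.over ()) (f j) ≠ 0 ∧ padicValRat p (line j.1 (toyIndex.over ()) (f j)) = 4 := by
  have hne : ((p : ℚ) ^ 4) ≠ 0 := pow_ne_zero _ (Nat.cast_ne_zero.mpr hp.out.ne_zero)
  rcases hf j with h | h
  · exact ⟨by rw [h]; exact hne, by rw [h, padicValRat_pow_nat]; rfl⟩
  · exact ⟨by rw [h]; exact neg_ne_zero.mpr hne, by rw [h, padicValRat.neg, padicValRat_pow_nat]; rfl⟩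

/-- **The ball generated by the standard-point datum is `B_{l⋇²} = B_4`** at every label `j ∈ 𝔽_l^⋇` (the unit ball at the junk
label `0`). [folklore] -/
theorem ballOfMonoid_stdQDatum (j : toyIndex.Label) (vQ : toyIndex.VQ) :
    ballOfMonoid p (fun v _ => stdQDatum p v) j vQ = pBall p j vQ (if j = 0 then 0 else 4) := by
  by_cases h : j = 0
  · subst h
    rw [ballOfMonoid_zero, if_pos rfl]
  · rw [if_neg h, ballOfMonoid_of_ne_zero p _ h]
    apply Set.Subset.antisymm
    · refine Set.iUnion₂_subset fun f hf => Set.iUnion_subset fun _ => ?_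
      rw [(line_stdQDatum_component p hf ⟨j, h⟩).2]
    · intro x hx
      refine Set.mem_iUnion₂.mpr ⟨_, stdTuple_mem_stdQDatum p (), Set.mem_iUnion.mpr ?_⟩
      exact ⟨(line_stdQDatum_component p (stdTuple_mem_stdQDatum p ()) ⟨j, h⟩).1,
        by rw [(line_stdQDatum_component p (stdTuple_mem_stdQDatum p ()) ⟨j, h⟩).2]; exact hx⟩

/-- The standard-point datum generates hull-sets. [folklore] -/
theorem stdQDatum_hul (j : toyIndex.Label) (vQ : toyIndex.VQ) :
    ∃ k : ℤ, pBall p j vQ k = ballOfMonoid p (fun v _ => stdQDatum p v) j vQ :=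
  ⟨_, (ballOfMonoid_stdQDatum p j vQ).symm⟩

/-- **`stdSetting p` — JOSHI'S STANDARD POINT IN THE NAIVE MODEL**: abc-iut-w5-d247's `withQDatum` setting over `naiveFull p`
(Θ-pilot Kummer images `B_{j²}` at every `(n, m)`) whose q-pilot region is the ball `B_{l⋇²} = B_4` generated by the standard-point
datum — the relative position «`|Θ_j| = |q|^{j²/l⋇²} ⊇ |q|`» of ATS III Thm. 7.3.1's proof (p. 56) in `K_1`-units. DATA of a toy;
no claim about the intended situation. [claim: Joshi2024ATSIII, status: disputed] -/
def stdSetting : Setting (naiveSituation p) := withQDatum p (fun v _ => stdQDatum p v) (stdQDatum_hul p)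

/-- The standard-point setting's q-pilot region: `B_4` on `𝔽_l^⋇`, `B_0` at the junk label. [folklore] -/
theorem stdSetting_qRegion (j : toyIndex.Label) (vQ : toyIndex.VQ) :
    (stdSetting p).qRegion j vQ = pBall p j vQ (if j = 0 then 0 else 4) :=
  ballOfMonoid_stdQDatum p j vQ

/-- … at a label `j ∈ 𝔽_l^⋇`: `B_4`. [folklore] -/
theorem stdSetting_qRegion_labelSucc (i : Fin toyIndex.lstar) (vQ : toyIndex.VQ) :
    (stdSetting p).qRegion (Setting.labelSucc i) vQ = pBall p _ vQ 4 := by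
  rw [stdSetting_qRegion, if_neg (Setting.labelSucc_ne_zero i)]

/-- (T-c) The THREE pins hold at the standard-point setting (abc-iut-w5-d247's `withQDatum_pinnedRegions3`).
[claim: Mochizuki2012, status: disputed] -/
theorem std_pinnedRegions3 :
    PinnedRegions3 (naiveFull p).toLatticeSituation (stdSetting p) (ballOfMonoid p) fun v _ => stdQDatum p v :=
  withQDatum_pinnedRegions3 p _ _

/-- (T-c) Every bridge hypothesis holds at the standard-point setting. [folklore] -/
theorem std_bridgeHyps : BridgeHyps (stdSetting p) := withQDatum_bridgeHyps p _ _

/-- In the naive model `j² ≤ l⋇²` at every label and `0 ≤ 0` at the junk label: the exponent comparison behind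
«`|ξ|^{j²/l⋇²} ≥ |ξ|`». [folklore] -/
theorem jsq_le_std (j : toyIndex.Label) : jsq j ≤ (if j = 0 then 0 else 4) := by
  revert j; decide

/-- **(T-c) H_J1 HOLDS at the standard-point setting** — with the IDENTITY indeterminacy and `m = 0`: `B_4 ⊆ B_{j²}` at `j = 1, 2`
(the scaling sits in the q-datum's normalisation; see the module docstring, HONEST SCOPE). [claim: Joshi2024ATSIII, status: disputed] -/
theorem std_joshiDominance :
    JoshiDominance (naiveFull p).toLatticeSituation (stdSetting p) (ballOfMonoid p) fun v _ => stdQDatum p v := by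
  intro j vQ
  refine ⟨1, Subgroup.one_mem _, 0, ?_⟩
  rw [naiveFull_frobΨ, ballOfMonoid_psi, ballOfMonoid_stdQDatum]
  have h1 : ((1 : signShells.PacketAut) j vQ) '' pBall p j vQ (jsq j) = pBall p j vQ (jsq j) := by simp
  rw [h1]
  exact pBall_mono p j vQ (jsq_le_std j)

/-- (T-c) H_J2 holds at the standard-point setting (from H_J1 under the pins). [claim: Joshi2024ATSIII, status: disputed] -/
theorem std_joshiVolumeDominance : JoshiVolumeDominance (stdSetting p) :=
  joshiVolumeDominance_of_joshiDominance _ _ _ _ (std_bridgeHyps p) (std_pinnedRegions3 p).1 (std_joshiDominance p)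

/-- **(T-c) The residual of record FAILS at the standard-point setting**: `PilotKummerIndRelated` would make the q-datum generate
the theta balls (abc-iut-w5-d247's `pilotKummerIndRelated_iff_generates_theta`), but at `j = 1` it generates `B_4 ≠ B_1`.
[claim: Mochizuki2012, status: disputed] -/
theorem std_not_pilotKummerIndRelated :
    ¬ PilotKummerIndRelated (naiveFull p).toLatticeSituation (stdSetting p) (ballOfMonoid p) fun v _ => stdQDatum p v := by
  intro h
  have h1 := (pilotKummerIndRelated_iff_generates_theta p _ (stdQDatum_hul p)).1 h 1 ()
  rw [ballOfMonoid_stdQDatum, if_neg (by decide)] at h1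
  have hj : jsq (1 : toyIndex.Label) = 1 := by decide
  rw [hj] at h1
  have := pBall_injective p 1 () h1
  omega

/-- (T-c) … hence abc-iut-w5-d068's REGION-level clause fails there (it is the residual, under (ii) (b) and (hρ)). [claim: Mochizuki2012, status: disputed] -/
theorem std_not_pilotKummerCompatRegion :
    ¬ PilotKummerCompatRegion (naiveFull p).toLatticeSituation (stdSetting p) (ballOfMonoid p) fun v _ => stdQDatum p v :=
  fun h => std_not_pilotKummerIndRelated p
    ((pilotKummerCompatRegion_iff_pilotKummerIndRelated (naiveFull p).toLatticeSituation (stdSetting p) (ballOfMonoid p)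
      (fun v _ => stdQDatum p v) (naive_kummerB p _) (ballOfMonoid_equivariant p)).1 h)

/-- (T-c) … and the DATUM-level clause fails there. [claim: Mochizuki2012, status: disputed] -/
theorem std_not_pilotKummerCompat :
    ¬ PilotKummerCompat (naiveFull p).toLatticeSituation (stdSetting p) fun v _ => stdQDatum p v :=
  fun h => std_not_pilotKummerCompatRegion p
    (pilotKummerCompatRegion_of_pilotKummerCompat (naiveFull p).toLatticeSituation (stdSetting p) (ballOfMonoid p)
      (fun v _ => stdQDatum p v) (ballOfMonoid_equivariant p) h)

/-- **(T-c) The typed Corollary 3.12 HOLDS at the standard-point setting — derived THROUGH H_J1** (`statement_of_joshiDominance`: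
the (T-a) theorem exercised at a contentful instance). [claim: Joshi2024ATSIII, status: disputed] -/
theorem std_statement : (stdSetting p).Statement :=
  statement_of_joshiDominance _ _ _ _ (std_bridgeHyps p) (std_pinnedRegions3 p).1 (std_joshiDominance p)

/-- (T-c) The (xi-f) `Licence` holds at the standard-point setting. [claim: Joshi2024ATSIII, status: disputed] -/
theorem std_licence : Thm311ToCor312.Licence (stdSetting p) :=
  licence_of_joshiDominance _ _ _ _ (std_pinnedRegions3 p).1 (std_joshiDominance p)

/-- The standard-point setting's local q-term at `j ∈ 𝔽_l^⋇` is `μ(B_4) = −4·log p = −l⋇²·log p`. [folklore] -/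
theorem std_qLocal_labelSucc (i : Fin toyIndex.lstar) (vQ : toyIndex.VQ) :
    (stdSetting p).qLocal (Setting.labelSucc i) vQ = -4 * Real.log p := by
  show pVol p _ vQ ((stdSetting p).qRegion (Setting.labelSucc i) vQ) = _
  rw [stdSetting_qRegion_labelSucc, pVol_pBall]; push_cast; ring

/-- **`−|log(q)| = −4·log p` at the standard-point setting** (`= l⋇²·` the honest q-volume `−log p`). [folklore] -/
theorem std_negLogQ : (stdSetting p).negLogQ = -4 * Real.log p := by
  unfold Setting.negLogQ
  have h : (fun i : Fin toyIndex.lstar => ∑ᶠ vQ : toyIndex.VQ, (stdSetting p).qLocal (Setting.labelSucc i) vQ) =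
      fun _ => -4 * Real.log p := by
    funext i
    rw [finsum_unique]
    exact std_qLocal_labelSucc p _ _
  rw [h]
  exact processionNormalized_const (by decide) _

/-- `−|log(Θ)| = −(5/2)·log p` at the standard-point setting (the Θ-side of every `withQDatum` setting). [folklore] -/
theorem std_negLogTheta : (stdSetting p).negLogTheta = ((-(5 / 2) * Real.log p : ℝ) : WithTop ℝ) :=
  withQDatum_negLogTheta p _ (stdQDatum_hul p)

/-- (T-c) "`|log(q)| > 0`" at the standard-point setting. [folklore] -/
theorem std_absLogQPos : (stdSetting p).AbsLogQPos := by
  show (stdSetting p).negLogQ < 0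
  rw [std_negLogQ]
  have := log_p_pos p
  linarith

/-- The two printed quantities at the standard point: `−|log(Θ)| = (5/8)·(−|log(q)|)` (`5/8 = (mean of j² over j ∈ {1,2})/l⋇²`,
the toy value of Joshi's `(l⋇+1)(2l⋇+1)/(6 l⋇²)`, ATS II §10), so the inequality holds with slack. [folklore] -/
theorem std_negLogTheta_eq_mul_negLogQ :
    (stdSetting p).negLogTheta = (((5 : ℝ) / 8 * (stdSetting p).negLogQ : ℝ) : WithTop ℝ) := by
  rw [std_negLogTheta, std_negLogQ]
  congr 1
  ring

end JoshiStd

/-! ## 2. The packaged (T-c) model and the separation from the residual -/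

section Packaged

open NaiveWitness Cor312.Checks Cor312.IdentifiedNonVacuity GluedMonoids.Naive

/-- **(T-c) JOSHI'S STANDARD POINT, PACKAGED.** There is an instantiation — over abc-iut-w5-d247's contentful typed-Thm-3.11 instance
`naiveFull 2` — with a region operator and a bad-place q-datum such that: the typed Theorem 3.11 (i) ∧ (ii) ∧ (iii) holds; every
bridge hypothesis holds; `|log(q)| > 0`; ALL THREE PINS hold; **H_J1 and H_J2 HOLD**; the residual of record `PilotKummerIndRelated`
and abc-iut-w5-d068's region- and datum-level clauses **FAIL**; the (xi-f) `Licence` and the typed Corollary 3.12 **HOLD**, with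
`−|log(Θ)| = (5/8)·(−|log(q)|)`. So H_J1 is CONSISTENT with the typed interface and the pins, and reaches the Statement WITHOUT the
identification-level residual. Interface/toy level; no judgement on print. [claim: Joshi2024ATSIII, status: disputed] -/
theorem joshi_standard_point_model :
    ∃ (T : ThetaIndex) (F : FullSituation T) (P : Setting F.toLatticeSituation.toSituation)
      (ρ : (∀ v : T.V, v ∈ T.Vbad → Set (F.L.StarPacket v)) → ∀ (j : T.Label) (vQ : T.VQ), Set (F.L.Packet j vQ))
      (qK : ∀ v : T.V, v ∈ T.Vbad → Set (F.L.StarPacket v)),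
      F.Statement ∧ BridgeHyps P ∧ P.AbsLogQPos ∧ PinnedRegions3 F.toLatticeSituation P ρ qK ∧
      JoshiDominance F.toLatticeSituation P ρ qK ∧ JoshiVolumeDominance P ∧
      ¬ PilotKummerIndRelated F.toLatticeSituation P ρ qK ∧ ¬ PilotKummerCompatRegion F.toLatticeSituation P ρ qK ∧
      ¬ PilotKummerCompat F.toLatticeSituation P qK ∧
      Thm311ToCor312.Licence P ∧ P.Statement ∧
      P.negLogTheta = (((5 : ℝ) / 8 * P.negLogQ : ℝ) : WithTop ℝ) := by
  haveI : Fact (Nat.Prime 2) := ⟨Nat.prime_two⟩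
  exact ⟨toyIndex, naiveFull 2, stdSetting 2, ballOfMonoid 2, fun v _ => stdQDatum 2 v, naiveFull_statement 2,
    std_bridgeHyps 2, std_absLogQPos 2, std_pinnedRegions3 2, std_joshiDominance 2, std_joshiVolumeDominance 2,
    std_not_pilotKummerIndRelated 2, std_not_pilotKummerCompatRegion 2, std_not_pilotKummerCompat 2, std_licence 2,
    std_statement 2, std_negLogTheta_eq_mul_negLogQ 2⟩

/-- **H_J1 IS STRICTLY WEAKER THAN THE RESIDUAL OF RECORD (as hypotheses over the frozen interface).** (a) On every lattice
situation with Thm. 3.11 (ii) (b) for its column and an (hρ)-equivariant operator, `PilotKummerIndRelated ⟹ JoshiDominance`; (b) the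
converse implication is NOT a theorem of the frozen vocabulary — refuted at the standard-point model, where (ii) (b) and (hρ) hold.
Both hypotheses give the printed Statement under the pins and the bridge hypotheses (`statement_of_joshiDominance`,
`statement_of_pinned3_of_pilotKummerIndRelated`); both fail at the pinned countermodel. [claim: Joshi2024ATSIII, status: disputed] -/
theorem joshiDominance_strictly_weaker_than_residual :
    (∀ (T : ThetaIndex) (S : LatticeSituation T) (P : Setting S.toSituation)
        (ρ : (∀ v : T.V, v ∈ T.Vbad → Set (S.L.StarPacket v)) → ∀ (j : T.Label) (vQ : T.VQ), Set (S.L.Packet j vQ))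
        (qK : ∀ v : T.V, v ∈ T.Vbad → Set (S.L.StarPacket v)),
        (S.col P.n).KummerB (S.D P.n) →
        (∀ Φ ∈ Subgroup.closure (S.L.Ind1Family ∪ S.L.Ind2Family),
          ∀ (Ψ : ∀ v : T.V, v ∈ T.Vbad → Set (S.L.StarPacket v)) (j : T.Label) (vQ : T.VQ),
            ρ (fun v hv => S.L.starAut Φ v '' Ψ v hv) j vQ = Φ j vQ '' ρ Ψ j vQ) →
        PilotKummerIndRelated S P ρ qK → JoshiDominance S P ρ qK) ∧
    ¬ (∀ (T : ThetaIndex) (S : LatticeSituation T) (P : Setting S.toSituation)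
        (ρ : (∀ v : T.V, v ∈ T.Vbad → Set (S.L.StarPacket v)) → ∀ (j : T.Label) (vQ : T.VQ), Set (S.L.Packet j vQ))
        (qK : ∀ v : T.V, v ∈ T.Vbad → Set (S.L.StarPacket v)),
        (S.col P.n).KummerB (S.D P.n) →
        (∀ Φ ∈ Subgroup.closure (S.L.Ind1Family ∪ S.L.Ind2Family),
          ∀ (Ψ : ∀ v : T.V, v ∈ T.Vbad → Set (S.L.StarPacket v)) (j : T.Label) (vQ : T.VQ),
            ρ (fun v hv => S.L.starAut Φ v '' Ψ v hv) j vQ = Φ j vQ '' ρ Ψ j vQ) →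
        JoshiDominance S P ρ qK → PilotKummerIndRelated S P ρ qK) := by
  refine ⟨fun T S P ρ qK hKumB hρ h => joshiDominance_of_pilotKummerIndRelated S P ρ qK hKumB hρ h, fun h => ?_⟩
  haveI : Fact (Nat.Prime 2) := ⟨Nat.prime_two⟩
  exact std_not_pilotKummerIndRelated 2
    (h toyIndex (naiveFull 2).toLatticeSituation (stdSetting 2) (ballOfMonoid 2) (fun v _ => stdQDatum 2 v)
      (naive_kummerB 2 _) (ballOfMonoid_equivariant 2) (std_joshiDominance 2))

end Packaged

end Summit.ABC.IUTFork.Repair.CandJoshi1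

end
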